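import Literature.NumberTheory.EllipticCurves.IwasawaCoinvariantsRankProofs
import Literature.NumberTheory.EllipticCurves.SelmerCorankProofs
import Mathlib.Topology.Algebra.Category.ProfiniteGrp.Basic
import HarnessLib

/-!
# Route `SignedLowerHalves`, crux L `SmallImageLowerHalfBothSigns` (stmt-BirchSwinnertonDyer-23599), line `rtt_w3` v11 — row L3-v of INJ,
# ABSTRACT HALF: a continuous cocycle of a profinite group `P = ⟨φ⟩·I·U` (Frobenius generation) with values in a discrete module on which the
# inertia `I` acts trivially and `φ − 1` is SURJECTIVE is a coboundary as soon as it vanishes on `I` (`H¹(Ẑ, A) = A/(F − 1)A`).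

LEAD `cruxlead-stmt-BirchSwinnertonDyer-23599` g6; helper `--supports stmt-BirchSwinnertonDyer-23599`; THEOREMS ONLY (generic Galois cohomology), no `sorry`;
closes nothing; BSD / crux L / INJ are NOT proved by this file.

WHY (HELPER-TABLE v11, row L3-v). B. D. Kim's layer group `S^{Σ₀,ε}(ℚ_n)` (`BDKim2009.nonPrimitiveSignedSelmerLayer`) asks, at every good `v ∉ Σ₀`,
`v ∤ p`, the CLASSICAL local condition `localKerOver` (Greenberg–Vatsal), whereas the character-road chain delivers classes UNRAMIFIED at `v`. Over `K_∞`
the tree's `unramKer_le_localKerOver_of_isCyclotomic` closes the gap by the pro-prime-to-`p` argument; at a FINITE layer `K_n` the right argument is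
divisibility: `H¹(Gal(K_{n,w}^{ur}/K_{n,w}), E[p^∞]) = E[p^∞]/(Frob_w − 1) = 0` because `Frob_w − 1` has finite kernel on the divisible `E[p^∞]`, hence is onto.
This file is the abstract cocycle statement; the instantiation (`P = Gal(K̄/K_n) ∩ D_v`, Frobenius generation inside `P`, surjectivity of `Frob_w − 1`
on `W[p^∞]`) is row L3-v's concrete half.

WHAT. ★ `exists_eq_smul_sub_of_frobenius_generation` — `G` profinite, `P, I ≤ G` with `I ≤ P`, `φ ∈ P`, every `d ∈ P` of the form `φⁿ·i·u` with
`i ∈ I`, `u` in any prescribed open subgroup of `G`; `D` discrete with continuous orbit maps, `I` acting trivially, `φ − 1` onto: every continuous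
`1`-cocycle of `P` vanishing on `I` is `x ↦ x•b − b`. Proof = the tree's `GreenbergVatsalStrictCore.exists_eq_smul_sub_of_vanishing_on_inertia_of_surjective`
with the `ℤ_p`-character bookkeeping removed: subtract the coboundary of `d` with `φ•d − d = g(φ)`; the zero set of the difference is an open subgroup of
`P` containing `φ`, `I` and `U ∩ P` for an open normal `U ≤ G`, hence everything.

References: [SerreLocalFields1979] XIII §1 (`H¹(Ẑ, A) = A/(F−1)A`); [SerreGaloisCohomology1997] I §2.2, §5.1; [GreenbergLNM1716] §2 p. 73;
[GreenbergVatsal2000] §2 p. 17.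
-/

set_option autoImplicit false
-- D-0017: single-problem summit, the namespace repeats the problem name by design.
set_option linter.dupNamespace false
noncomputable section

open scoped Pointwise

universe u

namespace Summit.BirchSwinnertonDyer.BirchSwinnertonDyer.Theorems.SmallImageCharSignedSelmer

open Literature.NumberTheory.GaloisRepresentations Literature.NumberTheory.EllipticCurves
  Literature.NumberTheory.EllipticCurves.ResKernel

section Frobenius

variable {G : Type u} [Group G] [TopologicalSpace G] [IsTopologicalGroup G] [CompactSpace G] [TotallyDisconnectedSpace G]
variable {D : Type u} [AddCommGroup D] [DistribMulAction G D] [TopologicalSpace D] [DiscreteTopology D]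

/-- ★ **`H¹(P/I, D) = 0` when `P/I` is topologically generated by a Frobenius `φ` with `φ − 1` onto `D`.** Let `G` be profinite, `I ≤ P ≤ G`,
`φ ∈ P`, and suppose every `d ∈ P` is `φⁿ·i·u` with `i ∈ I` and `u` in any given open subgroup of `G` (Frobenius generation of `P` modulo `I`).
Let `D` be a discrete `G`-module with continuous orbit maps on which `I` acts trivially and `φ − 1` is surjective. Then every continuous
`1`-cocycle of `P` with values in `D` that vanishes on `I` is a coboundary `x ↦ x•b − b`.
[cite: SerreLocalFields1979, XIII §1 Prop. 1] [cite: GreenbergLNM1716, §2 p. 73] -/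
theorem exists_eq_smul_sub_of_frobenius_generation {I P : Subgroup G} (hIP : I ≤ P) {φ : G} (hφP : φ ∈ P)
    (hdec : ∀ U : Subgroup G, IsOpen (U : Set G) → ∀ d : G, d ∈ P →
      ∃ (n : ℕ) (i u : G), i ∈ I ∧ u ∈ U ∧ d = φ ^ n * i * u)
    (hcont : ∀ d : D, Continuous fun g : G ↦ g • d)
    (hID : ∀ i ∈ I, ∀ d : D, i • d = d) (hsurj : ∀ d : D, ∃ d' : D, φ • d' - d' = d)
    (g : contOneCocycles (discreteTopRep P D)) (hg : ∀ x : P, (x : G) ∈ I → g.1 x = 0) :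
    ∃ b : D, ∀ x : P, g.1 x = (x : G) • b - b := by
  obtain ⟨d, hd⟩ := hsurj (g.1 ⟨φ, hφP⟩)
  set cb : contOneCocycles (discreteTopRep P D) :=
    cobCocycle d ((hcont d).comp continuous_subtype_val) with hcb
  have hδ : ∀ x : P, (g - cb).1 x = g.1 x - ((x : G) • d - d) := fun x ↦ by
    rw [Submodule.coe_sub, ContinuousMap.sub_apply]; rfl
  set Z := zeroSubgroup (g - cb) with hZ
  have hZφ : (⟨φ, hφP⟩ : P) ∈ Z := by
    rw [mem_zeroSubgroup_iff, hδ, ← hd]; exact sub_self _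
  have hZI : ∀ x : P, (x : G) ∈ I → x ∈ Z := fun x hx ↦ by
    rw [mem_zeroSubgroup_iff, hδ, hg x hx, hID _ hx d, sub_self, sub_zero]
  -- an open normal `U ≤ G` with `U ∩ P ⊆ Z`
  have hz : IsOpen (Z : Set P) := isOpen_zeroSubgroup _
  obtain ⟨O, hO, hOeq⟩ := isOpen_induced_iff.mp hz
  have h1O : (1 : G) ∈ O := by
    have : (1 : P) ∈ Subtype.val ⁻¹' O := by rw [hOeq]; exact Z.one_mem
    exact this
  obtain ⟨Un, hUn⟩ := ProfiniteGrp.exist_openNormalSubgroup_sub_open_nhds_of_one hO h1O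
  have hUZ : ∀ x : P, (x : G) ∈ (Un : Set G) → x ∈ Z := fun x hx ↦ by
    have : x ∈ Subtype.val ⁻¹' O := hUn hx
    rw [hOeq] at this
    exact this
  refine ⟨d, fun x ↦ ?_⟩
  suffices hxZ : x ∈ Z by
    rw [mem_zeroSubgroup_iff, hδ, sub_eq_zero] at hxZ; exact hxZ
  obtain ⟨n, i, u, hi, hu, hx⟩ := hdec Un.toSubgroup Un.isOpen x x.2
  have hiP : i ∈ P := hIP hi
  have hφnP : φ ^ n ∈ P := P.pow_mem hφP n
  have huP : u ∈ P := by
    have : u = (φ ^ n * i)⁻¹ * (x : G) := by rw [hx, ← mul_assoc, inv_mul_cancel, one_mul]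
    rw [this]
    exact P.mul_mem (P.inv_mem (P.mul_mem hφnP hiP)) x.2
  have hxeq : x = (⟨φ, hφP⟩ : P) ^ n * ⟨i, hiP⟩ * ⟨u, huP⟩ := Subtype.ext (by
    rw [Subgroup.coe_mul, Subgroup.coe_mul, Subgroup.coe_pow]; exact hx)
  rw [hxeq]
  exact Z.mul_mem (Z.mul_mem (Z.pow_mem hZφ n) (hZI _ hi)) (hUZ _ hu)

/-- **Class form**: under the same hypotheses every class of `H¹(P, D)` represented by a cocycle vanishing on `I` is zero — i.e. the
restriction `H¹(P, D) → H¹(I, D)` is injective («unramified ⇒ locally trivial» once instantiated at a decomposition group).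
[cite: SerreLocalFields1979, XIII §1 Prop. 1] [cite: GreenbergVatsal2000, §2 p. 17] -/
theorem oneCocycleClass_eq_zero_of_frobenius_generation {I P : Subgroup G} (hIP : I ≤ P) {φ : G} (hφP : φ ∈ P)
    (hdec : ∀ U : Subgroup G, IsOpen (U : Set G) → ∀ d : G, d ∈ P →
      ∃ (n : ℕ) (i u : G), i ∈ I ∧ u ∈ U ∧ d = φ ^ n * i * u)
    (hcont : ∀ d : D, Continuous fun g : G ↦ g • d)
    (hID : ∀ i ∈ I, ∀ d : D, i • d = d) (hsurj : ∀ d : D, ∃ d' : D, φ • d' - d' = d)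
    (g : contOneCocycles (discreteTopRep P D)) (hg : ∀ x : P, (x : G) ∈ I → g.1 x = 0) :
    oneCocycleClass (discreteTopRep P D) g = 0 := by
  obtain ⟨b, hb⟩ := exists_eq_smul_sub_of_frobenius_generation hIP hφP hdec hcont hID hsurj g hg
  have hcb : Continuous fun x : P ↦ x • b := (hcont b).comp continuous_subtype_val
  have hgb : g = cobCocycle b hcb := by
    apply Subtype.ext; apply ContinuousMap.ext; intro x
    rw [cobCocycle_apply]; exact hb x
  rw [hgb]
  exact oneCocycleClass_cobCocycle b hcb

end Frobenius

end Summit.BirchSwinnertonDyer.BirchSwinnertonDyer.Theorems.SmallImageCharSignedSelmer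

end
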